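import Summits.QuantumFields.YangMills.Theorems.BalabanUVNodesN11TStepBranchSum
import Summits.QuantumFields.YangMills.Theorems.BalabanUVNodesN11TkOpMeasurable
import Literature.MathematicalPhysics.QuantumFieldTheory.Balaban1983to89.Node00.RStepProvisosOfRecord

/-!
# DAG node N11 — THE PER-OLD-BRANCH GRAPH INTEGRABILITY ROW `hG₀` FROM def-T's GRAPH INTEGRABILITY OF THE STEP, POSITIVITY AND K0c-STYLE MEASURABILITY ROWS

HEADER — WORK-UNIT METADATA.  Cell `pub-ymgap`, YM-PLAN Track A (HUMAN RULING D-0062), seat `pub-ymgap-dag-n11-d` (g15; R134 fan-out base seat N11 [B14], strategy s2),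
route `BalabanUVNodes` rev 27, item K1⁸ `StabilityBRunRowsAtRecordR13SepCoPH` = stmt-QuantumFields-26907 (helper lane, `--kind proof --supports 26907 --as helper`,
count-neutral).  [III] = [Balaban1988Convergent].  Companion of this seat's `…N11TStepOldBranchInnerSum` (CLAIM-2 path 2: (O3′) on the nose from the level-`k` form at
`init s′` + PER-OLD-BRANCH rows `hG₀` ∕ `hin₀` ∕ `hinner₀` + `hint`), over 11a `Node00/TkOfRecord` (`tkOp_nonneg`, `genOp_nonneg`, `genDataOfRecord_laws`, `TkOfRecord_apply`),
this seat's g10 `…N11TkOpMeasurable` (`measurable_tkBranchOfRecord_baseCfg`, `measurable_tkWeightsOfRecordP_ζ ∕ _w`), def-R's `Node00/RStepProvisosOfRecord`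
(`chiSeqOfRecord_nonneg`), def-T v1.7 `Node00/Record13CoPH` (`WtOfRecord₁₃H_laws`) and `Node00/Sect2FormOfRecord` (`sect2Operand_pos`).

WHY THIS FILE.  The old-branch reduction asks, per old branch `S₀ ∈ admSOfRecord k (init s′)`, the `dU`-integrability `hG₀` of the graph piece
`U ↦ w(s′)(U,Ū)·χ_k(init s′)(U)·(𝐓_k(init s′,S₀)[W₀]Φ₀_{S₀})(base_k U)`.  These pieces are NONNEGATIVE (step weights and `χ_k` are decomposition-of-unity factors, `𝐓_k(·,S₀)` preserves
positivity under 11a's weight laws, the operand `e^{A_k}` is positive) and SUM, `dU`-a.e. on the `χ_k`-support, to def-T's graph integrand `w(s′)(U,Ū)·χ_k(init s′)(U)·slot_k(init s′)(U)`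
(Theorem 1's level-`k` form + `TkOfRecord_apply`) — so `hG₀` is NOT a new row: a finite family of nonnegative measurable functions with integrable sum is integrable member by member.
THIS FILE proves that, generically (§1), at 11a's letters (§2), and at a v1.7 parameter (§3) where the remaining inputs are def-T's graph integrability `hG` of the step, the
residual law `zhLaws`, and K0c-STYLE MEASURABILITY ROWS (graph section of the step weight, `χ_k`, the residual's `ζ0_j(Y)` ∕ `quad_j(Λ′)` serving `init s′`, the operand on the
multiscale configuration — the shapes of dag-n11-e's `ResidualRowsAt` ∕ `OperandRowsAt`).

WHAT THIS FILE PROVES (0 `def`, 0 `sorry`, standard axioms).  §1 `integrable_of_nonneg_of_integrable_finset_sum` (generic).  §2 `tkBranchOfRecord_nonneg` ·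
★★ `integrable_oldBranch_pieces_of_integrable_graph` (11a letters: `hG₀` for every old branch from `hG`, the a.e. level-`k` form, `0 ≤ w`, `W₀.Laws`, `0 ≤ Φ₀` and measurability
of `w`'s graph section, `χ_k`, `W₀.ζ`, `W₀.w`, `Φ₀_{S₀}`).  §3 ★★★ `integrable_oldBranch_pieces₁₃H_of_integrable_graph` (Stage-13 letters: `W₀ := WtOfRecord₁₃H θ p (init s′)`,
`Φ₀ := e^{A_k(init s′; t, Ek, U_k)}`; inputs `hG`, the form's a.e. clause, `zhLaws`, `0 ≤ w(s′)(·,Ū)` + measurability rows) — the `hG₀` binder of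
`…TStepOldBranchInnerSum.slotsTOfRecord₁₃H_succ_O3_of_hasSect2FormAtZS_of_oldBranchInnerSum` VERBATIM.

HONEST FRAMING.  Helper lane of K1⁸; count-neutral; measure-theory bookkeeping (`Integrable.mono`) + 11a positivity + this seat's measurability lemmas BY NAME; every remaining row
DISPLAYED; nothing of Bałaban asserted; (B4) ∕ (S-α) ∕ (O3′) NOT closed; N11 NOT discharged; K1⁸ NOT closed, no registered stub touched; counts unmoved (typed 28∕28 · discharged
5∕27 · A 5∕28).  One finite `𝕋⁴_{L^K}` programme at fixed `ε = L^{−K}`; R4 closes only the conditional finite-𝕋⁴ rung `BalabanLadder.UV` — NOT ℝ⁴, NOT OS, NOT a mass gap, NOT Clay.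
No `sorry`, `axiom`, `def`, `instance`, `notation`.  Sources (SHAPE ∕ bookkeeping only): [III] (2.17)–(2.18) p.257, (2.20)–(2.21) p.258, (3.1) p.264, (3.2)–(3.5) p.265, (3.24) p.270.
-/

noncomputable section

open MeasureTheory ProbabilityTheory
open scoped ENNReal NNReal BigOperators Matrix.Norms.L2Operator

namespace Summit.QuantumFields.YangMills.Theorems.BalabanUVNodesN11TStepOldBranchGraphIntegrable

open Literature.MathematicalPhysics.QuantumFieldTheory.Balaban1983to89
open Literature.MathematicalPhysics.QuantumFieldTheory.Balaban1983to89.T4AveragingDisintegration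
open BalabanUVNodesN11TkOpMeasurable (measurable_tkBranchOfRecord_baseCfg measurable_tkWeightsOfRecordP_ζ measurable_tkWeightsOfRecordP_w)
open Node00 hiding SU
open Node00.Tk T4Continuum B14.Eq218Concrete
open B10Eq42TorusConstraint (bondsIn)

/-! ## §1  Generic: a finite family of nonnegative measurable functions with integrable sum is integrable member by member -/

section Generic

variable {α : Type*} [MeasurableSpace α] {μ : Measure α}

/-- A FINITE FAMILY OF NONNEGATIVE a.e.-strongly-measurable functions WHOSE SUM IS INTEGRABLE is integrable member by member (`Integrable.mono` with `0 ≤ f_i ≤ Σ_j f_j`).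
[cite: Balaban1988Convergent, (2.18) p.257 (bookkeeping)] -/
theorem integrable_of_nonneg_of_integrable_finset_sum {I : Type*} (ι : Finset I) (f : I → α → ℝ) (h0 : ∀ i ∈ ι, ∀ x, 0 ≤ f i x)
    (hm : ∀ i ∈ ι, AEStronglyMeasurable (f i) μ) (hsum : Integrable (fun x => ∑ i ∈ ι, f i x) μ) :
    ∀ i ∈ ι, Integrable (f i) μ := fun i hi =>
  hsum.mono (hm i hi) (Filter.Eventually.of_forall fun x => by
    rw [Real.norm_eq_abs, Real.norm_eq_abs, abs_of_nonneg (h0 i hi x), abs_of_nonneg (Finset.sum_nonneg fun j hj => h0 j hj x)]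
    exact Finset.single_le_sum (fun j hj => h0 j hj x) hi)

end Generic

/-! ## §2  At 11a's letters: the old-branch graph pieces are nonnegative, measurable, and sum a.e. to the graph integrand — hence integrable -/

section Record

variable {F : T4Family} {N : ℕ} [NeZero N]
variable {V : Type} [NormedAddCommGroup V] [InnerProductSpace ℝ V] [FiniteDimensional ℝ V] [MeasurableSpace V] [BorelSpace V]

/-- **THE BRANCH OPERATOR OF RECORD PRESERVES POSITIVITY** under 11a's weight laws: `0 ≤ Φ ⇒ 0 ≤ 𝐓_k(s, S)[W]Φ` (`tkOp_nonneg` with `genOp_nonneg ∘ genDataOfRecord_laws`; the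
single-branch twin of 11a's `TkOfRecord_nonneg`). [cite: Balaban1988Convergent, (2.20)–(2.21) p.258] -/
theorem tkBranchOfRecord_nonneg (ν : Stage7Numerics) (M : ℕ) (g : ℕ → ℝ) (K : ℕ) {W : TkWeights F N V K} (hW : W.Laws) {n : ℕ} (s : SeqOfRecord F ν M g K n)
    (S : ℕ → Set (Site (F.P K) 0)) (k : ℕ) {Φ : MultiCfg (F.P K) (SU N) V → ℝ} (hΦ : ∀ ω, 0 ≤ Φ ω) (ω : MultiCfg (F.P K) (SU N) V) :
    0 ≤ tkBranchOfRecord F N V ν M g K W s S k Φ ω := by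
  unfold tkBranchOfRecord
  refine tkOp_nonneg _ (fun j _ hF' => ?_) k hΦ ω
  -- 11a's branch operator reads the CLASSICAL decidability instance on bonds (`open Classical in`); a local instance makes the laws match it
  letI : DecidableEq (PBond (F.P K) j) := fun a b => Classical.propDecidable (a = b)
  exact genOp_nonneg j (genDataOfRecord_laws F N V ν M g K hW s S j) hF'

/-- ★★ **THE PER-OLD-BRANCH GRAPH INTEGRABILITY `hG₀` FROM def-T's GRAPH INTEGRABILITY OF THE STEP**: at step `k` of the run `p`, history `s′` of length `k+1`, old pair
`(W₀, Φ₀)`: if the graph integrand `U ↦ w(s′)(U,Ū)·χ_k(init s′)(U)·slot_k(init s′)(U)` is `dU`-integrable (`hG`, def-T), the level-`k` form holds `dU`-a.e. on the `χ_k`-support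
(`hform`), the step weight's graph section is nonnegative and measurable, `χ_k(init s′)` is measurable, `W₀` obeys 11a's laws with measurable `ζ_j(Y)` ∕ `w_j(Λ′,Y,S)`, and the old
operand is nonnegative and measurable at every old branch — then EVERY old-branch piece `U ↦ w(s′)(U,Ū)·χ_k(init s′)(U)·(𝐓_k(init s′,S₀)[W₀]Φ₀_{S₀})(base_k U)` is `dU`-integrable.
[cite: Balaban1988Convergent, (2.17)–(2.18) p.257, (2.20)–(2.21) p.258, (3.1) p.264, (3.24) p.270] -/
theorem integrable_oldBranch_pieces_of_integrable_graph (ν : Stage7Numerics) (τ : TowerNumerics) (E : B12.RunParams → ℝ)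
    (w : StepWeightsOfRecord F N ν τ.M) (ppSel : PpSelOfRecord F ν τ.M) (p : B12.RunParams) (g : ℕ → ℝ) {k : ℕ}
    (s' : SeqOfRecord F ν τ.M g p.K (k + 1)) (W₀ : TkWeights F N V p.K) (Φ₀ : SFluct (F.P p.K) V → B15DeterminingSets.MSField (F.P p.K) (SU N) → ℝ)
    (hG : Integrable (fun U => w p g k s' U ((avOfRecord F N p.K k).avg U) *
      (chiSeqOfRecord F N ν τ.M g p.K k s'.init U * slotsOfRecord F N ν τ E w ppSel p g k s'.init U)) (fieldMeasure (F.P p.K) k (SU N)))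
    (hform : ∀ᵐ U ∂fieldMeasure (F.P p.K) k (SU N), chiSeqOfRecord F N ν τ.M g p.K k s'.init U ≠ 0 →
      slotsOfRecord F N ν τ E w ppSel p g k s'.init U = TkOfRecord F N V ν τ.M g p.K W₀ k s'.init Φ₀ U)
    (hw0 : ∀ U, 0 ≤ w p g k s' U ((avOfRecord F N p.K k).avg U)) (hwm : Measurable fun U => w p g k s' U ((avOfRecord F N p.K k).avg U))
    (hχm : Measurable (chiSeqOfRecord F N ν τ.M g p.K k s'.init))
    (hW₀ : W₀.Laws) (hζm : ∀ j Y, Measurable (W₀.ζ j Y)) (hwWm : ∀ j Λ' Y S, Measurable (W₀.w j Λ' Y S))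
    (hΦ₀ : ∀ a U, 0 ≤ Φ₀ a U)
    (hΦ₀m : ∀ S₀ ∈ admSOfRecord F ν τ.M g p.K k s'.init,
      Measurable fun ω : MultiCfg (F.P p.K) (SU N) V => Φ₀ (S₀, fun j => (ω j).2) (fun j => (ω j).1)) :
    ∀ S₀ ∈ admSOfRecord F ν τ.M g p.K k s'.init, Integrable (fun U => w p g k s' U ((avOfRecord F N p.K k).avg U) *
      (chiSeqOfRecord F N ν τ.M g p.K k s'.init U *
        tkBranchOfRecord F N V ν τ.M g p.K W₀ s'.init S₀ k (fun ω => Φ₀ (S₀, fun j => (ω j).2) (fun j => (ω j).1)) (baseCfg k U)))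
      (fieldMeasure (F.P p.K) k (SU N)) := by
  -- the pieces sum a.e. to the graph integrand
  have hGae : (fun U => w p g k s' U ((avOfRecord F N p.K k).avg U) *
        (chiSeqOfRecord F N ν τ.M g p.K k s'.init U * slotsOfRecord F N ν τ E w ppSel p g k s'.init U)) =ᵐ[fieldMeasure (F.P p.K) k (SU N)]
      fun U => ∑ S₀ ∈ admSOfRecord F ν τ.M g p.K k s'.init, w p g k s' U ((avOfRecord F N p.K k).avg U) *
        (chiSeqOfRecord F N ν τ.M g p.K k s'.init U *
          tkBranchOfRecord F N V ν τ.M g p.K W₀ s'.init S₀ k (fun ω => Φ₀ (S₀, fun j => (ω j).2) (fun j => (ω j).1)) (baseCfg k U)) := by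
    filter_upwards [hform] with U hU
    by_cases hχ : chiSeqOfRecord F N ν τ.M g p.K k s'.init U = 0
    · simp only [hχ, zero_mul, mul_zero, Finset.sum_const_zero]
    · rw [hU hχ, TkOfRecord_apply, Finset.mul_sum, Finset.mul_sum]
  refine integrable_of_nonneg_of_integrable_finset_sum (admSOfRecord F ν τ.M g p.K k s'.init) _ ?_ ?_ (hG.congr hGae)
  · intro S₀ _ U
    exact mul_nonneg (hw0 U) (mul_nonneg (chiSeqOfRecord_nonneg F N ν τ.M g p.K k s'.init U)
      (tkBranchOfRecord_nonneg ν τ.M g p.K hW₀ s'.init S₀ k (fun ω => hΦ₀ _ _) _))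
  · intro S₀ h₀
    exact (hwm.mul (hχm.mul (measurable_tkBranchOfRecord_baseCfg F N V ν τ.M g p.K W₀ hζm hwWm s'.init S₀ k (hΦ₀m S₀ h₀)))).aestronglyMeasurable

/-! ## §3  At a v1.7 parameter: `hG₀` of the Stage-13 old-branch theorem from `hG`, the form, `zhLaws` and measurability rows -/

/-- ★★★ **`hG₀` AT A v1.7 PARAMETER**: at `θ : Stage13HParams F N`, run `p`, step `k`, history `s′` of length `k+1`, and a level-`k` witness family `(t, Ek)` whose form holds
`dU`-a.e. on the `χ_k`-support at `init s′` (the a.e. clause of `HasSect2FormAtZS`): from def-T's graph integrability `hG` of the step, the history-indexed residual law `zhLaws`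
(`∀ p n Ω Λ, (θ.Zh p n Ω Λ).Laws`), nonnegativity + measurability of the step weight's graph section, measurability of `χ_k(init s′)`, of the residual's `ζ0_j(Y)` ∕ `quad_j(Λ′)`
serving `init s′` (dag-n11-e's `ResidualRowsAt` shapes) and of the old operand on the multiscale configuration at every old branch (`OperandRowsAt` shape) — the per-old-branch
graph integrability binder `hG₀` of `…TStepOldBranchInnerSum.slotsTOfRecord₁₃H_succ_O3_of_hasSect2FormAtZS_of_oldBranchInnerSum`, VERBATIM.
[cite: Balaban1988Convergent, (2.17)–(2.18) p.257, (2.20)–(2.21) p.258, (3.1) p.264, (3.24) p.270] -/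
theorem integrable_oldBranch_pieces₁₃H_of_integrable_graph (θ : Stage13HParams F N) (p : B12.RunParams) {k : ℕ}
    (s' : SeqOfRecord F θ.ν θ.τ9.M (gOfRecord₁₃ F N θ.toStage13Params p) p.K (k + 1))
    (t : SeqOfRecord F θ.ν θ.τ9.M (gOfRecord₁₃ F N θ.toStage13Params p) p.K k → Sect2.TermValues (F.P p.K) (MatA N) (FluctV N) θ.τ9.M)
    (Ek : SeqOfRecord F θ.ν θ.τ9.M (gOfRecord₁₃ F N θ.toStage13Params p) p.K k → ℝ)
    (hG : Integrable (fun U => wOfRecord₉ F N θ.toStage9Params p (gOfRecord₁₃ F N θ.toStage13Params p) k s' U ((avOfRecord F N p.K k).avg U) *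
      (chiSeqOfRecord F N θ.ν θ.τ9.M (gOfRecord₁₃ F N θ.toStage13Params p) p.K k s'.init U *
        slotsOfRecord F N θ.ν θ.τ9 (EOfRecord₁₃ F N θ.toStage13Params) (wOfRecord₉ F N θ.toStage9Params) θ.ppSel p (gOfRecord₁₃ F N θ.toStage13Params p) k s'.init U))
      (fieldMeasure (F.P p.K) k (SU N)))
    (hform : ∀ᵐ U ∂fieldMeasure (F.P p.K) k (SU N), chiSeqOfRecord F N θ.ν θ.τ9.M (gOfRecord₁₃ F N θ.toStage13Params p) p.K k s'.init U ≠ 0 →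
      slotsOfRecord F N θ.ν θ.τ9 (EOfRecord₁₃ F N θ.toStage13Params) (wOfRecord₉ F N θ.toStage9Params) θ.ppSel p (gOfRecord₁₃ F N θ.toStage13Params p) k s'.init U =
        sect2Slot F N (FluctV N) p.K (settingOfRecord₁₃ F N θ.toStage13Params p) (θ.rzAt p s'.init) (WtOfRecord₁₃H F N θ p s'.init) s'.init (t s'.init) (Ek s'.init)
          (UbgOfRecord₁₃CoP F N θ.toStage13Params p k s'.init) U)
    (hZ : ∀ p n Ω Λ, (θ.Zh p n Ω Λ).Laws)
    (hw0 : ∀ U, 0 ≤ wOfRecord₉ F N θ.toStage9Params p (gOfRecord₁₃ F N θ.toStage13Params p) k s' U ((avOfRecord F N p.K k).avg U))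
    (hwm : Measurable fun U => wOfRecord₉ F N θ.toStage9Params p (gOfRecord₁₃ F N θ.toStage13Params p) k s' U ((avOfRecord F N p.K k).avg U))
    (hχm : Measurable fun U => chiSeqOfRecord F N θ.ν θ.τ9.M (gOfRecord₁₃ F N θ.toStage13Params p) p.K k s'.init U)
    (hζ0m : ∀ j Y, Measurable ((θ.zhAt p s'.init).ζ0 j Y)) (hqm : ∀ j Λ', Measurable ((θ.zhAt p s'.init).quad j Λ'))
    (hΦ₀m : ∀ S₀ ∈ admSOfRecord F θ.ν θ.τ9.M (gOfRecord₁₃ F N θ.toStage13Params p) p.K k s'.init,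
      Measurable fun ω : MultiCfg (F.P p.K) (SU N) (FluctV N) =>
        (sect2Operand F N (FluctV N) p.K (settingOfRecord₁₃ F N θ.toStage13Params p) (θ.rzAt p s'.init) s'.init (t s'.init) (Ek s'.init)
            (UbgOfRecord₁₃CoP F N θ.toStage13Params p k s'.init)) (S₀, fun j => (ω j).2) (fun j => (ω j).1)) :
    ∀ S₀ ∈ admSOfRecord F θ.ν θ.τ9.M (gOfRecord₁₃ F N θ.toStage13Params p) p.K k s'.init, Integrable (fun U => wOfRecord₉ F N θ.toStage9Params p (gOfRecord₁₃ F N θ.toStage13Params p) k s' U ((avOfRecord F N p.K k).avg U) *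
      (chiSeqOfRecord F N θ.ν θ.τ9.M (gOfRecord₁₃ F N θ.toStage13Params p) p.K k s'.init U *
        tkBranchOfRecord F N (FluctV N) θ.ν θ.τ9.M (gOfRecord₁₃ F N θ.toStage13Params p) p.K (WtOfRecord₁₃H F N θ p s'.init) s'.init S₀ k
          (fun ω => (sect2Operand F N (FluctV N) p.K (settingOfRecord₁₃ F N θ.toStage13Params p) (θ.rzAt p s'.init) s'.init (t s'.init) (Ek s'.init)
            (UbgOfRecord₁₃CoP F N θ.toStage13Params p k s'.init)) (S₀, fun j => (ω j).2) (fun j => (ω j).1)) (baseCfg k U)))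
      (fieldMeasure (F.P p.K) k (SU N)) :=
  integrable_oldBranch_pieces_of_integrable_graph θ.ν θ.τ9 (EOfRecord₁₃ F N θ.toStage13Params) (wOfRecord₉ F N θ.toStage9Params) θ.ppSel p (gOfRecord₁₃ F N θ.toStage13Params p) s'
    (WtOfRecord₁₃H F N θ p s'.init)
    (sect2Operand F N (FluctV N) p.K (settingOfRecord₁₃ F N θ.toStage13Params p) (θ.rzAt p s'.init) s'.init (t s'.init) (Ek s'.init)
            (UbgOfRecord₁₃CoP F N θ.toStage13Params p k s'.init))
    hG hform hw0 hwm hχm (WtOfRecord₁₃H_laws hZ p s'.init)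
    (fun j Y => measurable_tkWeightsOfRecordP_ζ F N (FluctV N) θ.ν θ.A₁ p (gOfRecord₁₃ F N θ.toStage13Params p) (θ.zhAt p s'.init) j Y (hζ0m j Y))
    (fun j Λ' Y S => measurable_tkWeightsOfRecordP_w F N (FluctV N) θ.ν θ.A₁ p (gOfRecord₁₃ F N θ.toStage13Params p) (θ.zhAt p s'.init) j Λ' Y S (hqm j Λ'))
    (fun a U => (sect2Operand_pos p.K _ _ s'.init _ _ _ a U).le) hΦ₀m

end Record

end Summit.QuantumFields.YangMills.Theorems.BalabanUVNodesN11TStepOldBranchGraphIntegrable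

end
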